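import Summits.CriticalPhenomena.PercolationContinuityZ3.Theorems.PercNearOneGluingNoHeavyLowerTailAntipodalR1TwoCutContractGraded
import Summits.CriticalPhenomena.PercolationContinuityZ3.Theorems.PercNearOneGluingNoHeavyLowerTailAntipodalR1CutVertexGraded
import Summits.CriticalPhenomena.PercolationContinuityZ3.Theorems.PercNearOneGluingNoHeavyLowerTailAntipodalR1Reindex
import HarnessLib

/-!
# ANTI₁-GRADED implies its fibre form, I: base case and relabelling

Support file for `stmt-CriticalPhenomena-4575` (memo `prim-gen-kcluster/KCLUSTER-gen52.md` §1, LEMMA F —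
the combinatorial half; `KCLUSTER-gen78.md`).  No definitions, no named facts, no sorries.  Vocabulary of
`AntipodalR1` (gen 62), parts IV/V/IX (loops, contraction, graded contraction) and the relabelling lemmas
of gen 78.

In the fibre decomposition of a product of two random-cluster measures (gen-52 LEMMA F), a fibre is a
set of free edges together with a set of edges that are open in BOTH copies; in the antipodal dictionary
the latter join their ends in both the open and the closed graph — an open and a closed parallel pair —
and the fibre inequality is ANTI₁-GRADED restricted to the colourings `A ⊕ (p ↦ p.2)` of the system
`Sum.elim endsD (fun p : κ × Bool => f p.1)` ("fibre form").

**Theorem** (`card_fibreForm_grade_le_of_graded`).  Fix the (finite) vertex type `V` and the free edge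
type `ι`.  If ANTI₁-GRADED holds for EVERY system `ends' : ι → Sym2 V` (all placements `a, b, c`, all
levels), then the fibre form holds for every `endsD : ι → Sym2 V`, every finite family of doubled edges
`f : κ → Sym2 V`, all `a, b, c` and all levels.  Proof: induction on `κ` (`Finite.induction_empty_option`);
a doubled edge `uv` with `u ≠ v` is contracted (part IX: the fibre over the pair is the contraction at the
level shifted by `2`, and the contraction of a pair system is again a pair system on the same edge types),
a doubled loop is deleted (part IV), relabellings by `…Reindex`.  [this work]
-/

namespace Summit.CriticalPhenomena.PercolationContinuityZ3.Theorems

namespace AntipodalR1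

open Finset Relation SimpleGraph

universe w w'

variable {V ι : Type*} [DecidableEq V] [Fintype V] [Fintype ι] [DecidableEq ι]

section Steps

omit [DecidableEq V] [Fintype V] in
/-- **Base.**  With no doubled edge the fibre form is ANTI₁-GRADED for `endsD` itself. [this work] -/
theorem card_fibreForm_grade_le_empty
    (H : ∀ (ends' : ι → Sym2 V) (a b c : V) (t : ℕ),
      (univ.filter fun x : ι → Bool => x ∈ lSet ends' a b c ∧
        (Nat.card (fromEdgeSet {s : Sym2 V | ∃ e, x e = true ∧
          ends' e = s}).ConnectedComponent +
        Nat.card (fromEdgeSet {s : Sym2 V | ∃ e, x e = false ∧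
          ends' e = s}).ConnectedComponent) = t).card ≤
      (univ.filter fun x : ι → Bool => x ∈ rSet ends' a b c ∧
        (Nat.card (fromEdgeSet {s : Sym2 V | ∃ e, x e = true ∧
          ends' e = s}).ConnectedComponent +
        Nat.card (fromEdgeSet {s : Sym2 V | ∃ e, x e = false ∧
          ends' e = s}).ConnectedComponent) = t).card)
    (f : PEmpty.{w + 1} → Sym2 V) (endsD : ι → Sym2 V) (a b c : V) (t : ℕ) :
    (univ.filter fun A : ι → Bool =>
        Sum.elim A Prod.snd ∈ lSet (Sum.elim endsD (fun p : PEmpty.{w + 1} × Bool => f p.1)) a b c ∧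
        (Nat.card (fromEdgeSet {s : Sym2 V | ∃ e, Sum.elim A Prod.snd e = true ∧
          (Sum.elim endsD (fun p : PEmpty.{w + 1} × Bool => f p.1)) e = s}).ConnectedComponent +
        Nat.card (fromEdgeSet {s : Sym2 V | ∃ e, Sum.elim A Prod.snd e = false ∧
          (Sum.elim endsD (fun p : PEmpty.{w + 1} × Bool => f p.1)) e = s}).ConnectedComponent) = t).card ≤
      (univ.filter fun A : ι → Bool =>
        Sum.elim A Prod.snd ∈ rSet (Sum.elim endsD (fun p : PEmpty.{w + 1} × Bool => f p.1)) a b c ∧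
        (Nat.card (fromEdgeSet {s : Sym2 V | ∃ e, Sum.elim A Prod.snd e = true ∧
          (Sum.elim endsD (fun p : PEmpty.{w + 1} × Bool => f p.1)) e = s}).ConnectedComponent +
        Nat.card (fromEdgeSet {s : Sym2 V | ∃ e, Sum.elim A Prod.snd e = false ∧
          (Sum.elim endsD (fun p : PEmpty.{w + 1} × Bool => f p.1)) e = s}).ConnectedComponent) = t).card := by
  classical
  let e : ι ≃ ι ⊕ (PEmpty.{w + 1} × Bool) :=
    ⟨Sum.inl, fun z => Sum.elim id (fun p => p.1.elim) z, fun _ => rfl,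
      fun z => match z with
        | Sum.inl _ => rfl
        | Sum.inr ⟨p, _⟩ => p.elim⟩
  have hsys : (Sum.elim endsD (fun p : PEmpty.{w + 1} × Bool => f p.1)) ∘ e = endsD :=
    funext fun _ => rfl
  have hcol : ∀ A : ι → Bool,
      (Sum.elim A Prod.snd : ι ⊕ (PEmpty.{w + 1} × Bool) → Bool) ∘ e = A :=
    fun A => funext fun _ => rfl
  have hL : ∀ A : ι → Bool,
      Sum.elim A Prod.snd ∈ lSet (Sum.elim endsD (fun p : PEmpty.{w + 1} × Bool => f p.1)) a b c ↔
      A ∈ lSet endsD a b c := by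
    intro A; rw [← mem_lSet_comp_equiv e, hsys, hcol]
  have hR : ∀ A : ι → Bool,
      Sum.elim A Prod.snd ∈ rSet (Sum.elim endsD (fun p : PEmpty.{w + 1} × Bool => f p.1)) a b c ↔
      A ∈ rSet endsD a b c := by
    intro A; rw [← mem_rSet_comp_equiv e, hsys, hcol]
  have hg : ∀ (A : ι → Bool) (col : Bool),
      fromEdgeSet {s : Sym2 V | ∃ x, Sum.elim A Prod.snd x = col ∧
        Sum.elim endsD (fun p : PEmpty.{w + 1} × Bool => f p.1) x = s} =
      fromEdgeSet {s : Sym2 V | ∃ i, A i = col ∧ endsD i = s} := by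
    intro A col
    rw [← colGraph_comp_equiv e (Sum.elim endsD (fun p : PEmpty.{w + 1} × Bool => f p.1))
      (Sum.elim A Prod.snd) col, hsys, hcol]
  have e1 : (univ.filter fun A : ι → Bool =>
        Sum.elim A Prod.snd ∈ lSet (Sum.elim endsD (fun p : PEmpty.{w + 1} × Bool => f p.1)) a b c ∧
        (Nat.card (fromEdgeSet {s : Sym2 V | ∃ e, Sum.elim A Prod.snd e = true ∧
          (Sum.elim endsD (fun p : PEmpty.{w + 1} × Bool => f p.1)) e = s}).ConnectedComponent +
        Nat.card (fromEdgeSet {s : Sym2 V | ∃ e, Sum.elim A Prod.snd e = false ∧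
          (Sum.elim endsD (fun p : PEmpty.{w + 1} × Bool => f p.1)) e = s}).ConnectedComponent) = t).card =
      (univ.filter fun x : ι → Bool => x ∈ lSet endsD a b c ∧
        (Nat.card (fromEdgeSet {s : Sym2 V | ∃ e, x e = true ∧
          endsD e = s}).ConnectedComponent +
        Nat.card (fromEdgeSet {s : Sym2 V | ∃ e, x e = false ∧
          endsD e = s}).ConnectedComponent) = t).card :=
    congrArg Finset.card (filter_congr fun A _ => by rw [hL, hg, hg])
  have e2 : (univ.filter fun A : ι → Bool =>
        Sum.elim A Prod.snd ∈ rSet (Sum.elim endsD (fun p : PEmpty.{w + 1} × Bool => f p.1)) a b c ∧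
        (Nat.card (fromEdgeSet {s : Sym2 V | ∃ e, Sum.elim A Prod.snd e = true ∧
          (Sum.elim endsD (fun p : PEmpty.{w + 1} × Bool => f p.1)) e = s}).ConnectedComponent +
        Nat.card (fromEdgeSet {s : Sym2 V | ∃ e, Sum.elim A Prod.snd e = false ∧
          (Sum.elim endsD (fun p : PEmpty.{w + 1} × Bool => f p.1)) e = s}).ConnectedComponent) = t).card =
      (univ.filter fun x : ι → Bool => x ∈ rSet endsD a b c ∧
        (Nat.card (fromEdgeSet {s : Sym2 V | ∃ e, x e = true ∧
          endsD e = s}).ConnectedComponent +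
        Nat.card (fromEdgeSet {s : Sym2 V | ∃ e, x e = false ∧
          endsD e = s}).ConnectedComponent) = t).card :=
    congrArg Finset.card (filter_congr fun A _ => by rw [hR, hg, hg])
  rw [e1, e2]; exact H endsD a b c t

omit [DecidableEq V] [Fintype V] in
/-- **Relabelling the doubled edges.** [this work] -/
theorem card_fibreForm_grade_le_of_equiv {κ : Type w} {κ' : Type w'} [Fintype κ] [DecidableEq κ]
    [Fintype κ']
    [DecidableEq κ'] (eκ : κ ≃ κ')
    (h : ∀ (f : κ → Sym2 V) (endsD : ι → Sym2 V) (a b c : V) (t : ℕ),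
      (univ.filter fun A : ι → Bool =>
        Sum.elim A Prod.snd ∈ lSet (Sum.elim endsD (fun p : κ × Bool => f p.1)) a b c ∧
        (Nat.card (fromEdgeSet {s : Sym2 V | ∃ e, Sum.elim A Prod.snd e = true ∧
          (Sum.elim endsD (fun p : κ × Bool => f p.1)) e = s}).ConnectedComponent +
        Nat.card (fromEdgeSet {s : Sym2 V | ∃ e, Sum.elim A Prod.snd e = false ∧
          (Sum.elim endsD (fun p : κ × Bool => f p.1)) e = s}).ConnectedComponent) = t).card ≤
      (univ.filter fun A : ι → Bool =>
        Sum.elim A Prod.snd ∈ rSet (Sum.elim endsD (fun p : κ × Bool => f p.1)) a b c ∧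
        (Nat.card (fromEdgeSet {s : Sym2 V | ∃ e, Sum.elim A Prod.snd e = true ∧
          (Sum.elim endsD (fun p : κ × Bool => f p.1)) e = s}).ConnectedComponent +
        Nat.card (fromEdgeSet {s : Sym2 V | ∃ e, Sum.elim A Prod.snd e = false ∧
          (Sum.elim endsD (fun p : κ × Bool => f p.1)) e = s}).ConnectedComponent) = t).card)
    (f : κ' → Sym2 V) (endsD : ι → Sym2 V) (a b c : V) (t : ℕ) :
    (univ.filter fun A : ι → Bool =>
        Sum.elim A Prod.snd ∈ lSet (Sum.elim endsD (fun p : κ' × Bool => f p.1)) a b c ∧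
        (Nat.card (fromEdgeSet {s : Sym2 V | ∃ e, Sum.elim A Prod.snd e = true ∧
          (Sum.elim endsD (fun p : κ' × Bool => f p.1)) e = s}).ConnectedComponent +
        Nat.card (fromEdgeSet {s : Sym2 V | ∃ e, Sum.elim A Prod.snd e = false ∧
          (Sum.elim endsD (fun p : κ' × Bool => f p.1)) e = s}).ConnectedComponent) = t).card ≤
      (univ.filter fun A : ι → Bool =>
        Sum.elim A Prod.snd ∈ rSet (Sum.elim endsD (fun p : κ' × Bool => f p.1)) a b c ∧
        (Nat.card (fromEdgeSet {s : Sym2 V | ∃ e, Sum.elim A Prod.snd e = true ∧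
          (Sum.elim endsD (fun p : κ' × Bool => f p.1)) e = s}).ConnectedComponent +
        Nat.card (fromEdgeSet {s : Sym2 V | ∃ e, Sum.elim A Prod.snd e = false ∧
          (Sum.elim endsD (fun p : κ' × Bool => f p.1)) e = s}).ConnectedComponent) = t).card := by
  classical
  let e : ι ⊕ (κ × Bool) ≃ ι ⊕ (κ' × Bool) :=
    Equiv.sumCongr (Equiv.refl ι) (Equiv.prodCongr eκ (Equiv.refl Bool))
  have hsys : (Sum.elim endsD (fun p : κ' × Bool => f p.1)) ∘ e =
      Sum.elim endsD (fun p : κ × Bool => (f ∘ eκ) p.1) := by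
    funext z; rcases z with i | ⟨k, β⟩ <;> rfl
  have hcol : ∀ A : ι → Bool, (Sum.elim A Prod.snd : ι ⊕ (κ' × Bool) → Bool) ∘ e =
      (Sum.elim A Prod.snd : ι ⊕ (κ × Bool) → Bool) := by
    intro A; funext z; rcases z with i | ⟨k, β⟩ <;> rfl
  have hL : ∀ A : ι → Bool,
      Sum.elim A Prod.snd ∈ lSet (Sum.elim endsD (fun p : κ' × Bool => f p.1)) a b c ↔
      Sum.elim A Prod.snd ∈ lSet (Sum.elim endsD (fun p : κ × Bool => (f ∘ eκ) p.1)) a b c := by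
    intro A; rw [← mem_lSet_comp_equiv e, hsys, hcol]
  have hR : ∀ A : ι → Bool,
      Sum.elim A Prod.snd ∈ rSet (Sum.elim endsD (fun p : κ' × Bool => f p.1)) a b c ↔
      Sum.elim A Prod.snd ∈ rSet (Sum.elim endsD (fun p : κ × Bool => (f ∘ eκ) p.1)) a b c := by
    intro A; rw [← mem_rSet_comp_equiv e, hsys, hcol]
  have hg : ∀ (A : ι → Bool) (col : Bool),
      fromEdgeSet {s : Sym2 V | ∃ x, Sum.elim A Prod.snd x = col ∧
        Sum.elim endsD (fun p : κ' × Bool => f p.1) x = s} =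
      fromEdgeSet {s : Sym2 V | ∃ x, Sum.elim A Prod.snd x = col ∧
        Sum.elim endsD (fun p : κ × Bool => (f ∘ eκ) p.1) x = s} := by
    intro A col
    rw [← colGraph_comp_equiv e (Sum.elim endsD (fun p : κ' × Bool => f p.1))
      (Sum.elim A Prod.snd) col, hsys, hcol]
  have e1 : (univ.filter fun A : ι → Bool =>
        Sum.elim A Prod.snd ∈ lSet (Sum.elim endsD (fun p : κ' × Bool => f p.1)) a b c ∧
        (Nat.card (fromEdgeSet {s : Sym2 V | ∃ e, Sum.elim A Prod.snd e = true ∧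
          (Sum.elim endsD (fun p : κ' × Bool => f p.1)) e = s}).ConnectedComponent +
        Nat.card (fromEdgeSet {s : Sym2 V | ∃ e, Sum.elim A Prod.snd e = false ∧
          (Sum.elim endsD (fun p : κ' × Bool => f p.1)) e = s}).ConnectedComponent) = t).card =
      (univ.filter fun A : ι → Bool =>
        Sum.elim A Prod.snd ∈ lSet (Sum.elim endsD (fun p : κ × Bool => (f ∘ eκ) p.1)) a b c ∧
        (Nat.card (fromEdgeSet {s : Sym2 V | ∃ e, Sum.elim A Prod.snd e = true ∧
          (Sum.elim endsD (fun p : κ × Bool => (f ∘ eκ) p.1)) e = s}).ConnectedComponent +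
        Nat.card (fromEdgeSet {s : Sym2 V | ∃ e, Sum.elim A Prod.snd e = false ∧
          (Sum.elim endsD (fun p : κ × Bool => (f ∘ eκ) p.1)) e = s}).ConnectedComponent) = t).card :=
    congrArg Finset.card (filter_congr fun A _ => by rw [hL, hg, hg])
  have e2 : (univ.filter fun A : ι → Bool =>
        Sum.elim A Prod.snd ∈ rSet (Sum.elim endsD (fun p : κ' × Bool => f p.1)) a b c ∧
        (Nat.card (fromEdgeSet {s : Sym2 V | ∃ e, Sum.elim A Prod.snd e = true ∧
          (Sum.elim endsD (fun p : κ' × Bool => f p.1)) e = s}).ConnectedComponent +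
        Nat.card (fromEdgeSet {s : Sym2 V | ∃ e, Sum.elim A Prod.snd e = false ∧
          (Sum.elim endsD (fun p : κ' × Bool => f p.1)) e = s}).ConnectedComponent) = t).card =
      (univ.filter fun A : ι → Bool =>
        Sum.elim A Prod.snd ∈ rSet (Sum.elim endsD (fun p : κ × Bool => (f ∘ eκ) p.1)) a b c ∧
        (Nat.card (fromEdgeSet {s : Sym2 V | ∃ e, Sum.elim A Prod.snd e = true ∧
          (Sum.elim endsD (fun p : κ × Bool => (f ∘ eκ) p.1)) e = s}).ConnectedComponent +
        Nat.card (fromEdgeSet {s : Sym2 V | ∃ e, Sum.elim A Prod.snd e = false ∧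
          (Sum.elim endsD (fun p : κ × Bool => (f ∘ eκ) p.1)) e = s}).ConnectedComponent) = t).card :=
    congrArg Finset.card (filter_congr fun A _ => by rw [hR, hg, hg])
  rw [e1, e2]; exact h (f ∘ eκ) endsD a b c t

end Steps

end AntipodalR1

end Summit.CriticalPhenomena.PercolationContinuityZ3.Theorems
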